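import Summits.QuantumFields.YangMills.Theorems.UnitScaleTiltProp7SectET3ObjectsPd
import Summits.QuantumFields.YangMills.Theorems.UnitScaleTiltProp7SectET3TransportTower
import HarnessLib

/-!
# Route `UnitScaleTilt`, crux K1 child «MinimiserStabilityRegPr» (stmt-QuantumFields-19200), stub `stub_existenceMinimalOrbit` (EX), route (α) — (S2-obj)∕P6@T³ AT THE LATTICE
# OF RECORD: the rows of `…Prop7SectET3ObjectsPd` (p597247) SPECIALISED at ★w4-20520 g2's chart `Prop7SectET3TransportTower.siteEquivTower F n K h` (p598171) to the
# tower lattice `TSite 3 (towerP F.L (towerPeriodsT3 F n) (K − n))` on which the (115)-letters `(H̃_{1,k}, C_k)`, `W80` are typed (OWNER RULING (J) 2026-08-28T02:14:16Z)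

Cell `ym3-torus`, width seat `ym-ust-19200-w2` (gen 2; the `_tower` twins this seat owes per its 02:19:52Z ACK of RULING (J), APPROVED 02:21:57Z).  YM₃ on T³ is a ladder
rung (R3), not the Clay problem; nothing here claims the stub, the crux, d = 4 or the mass gap.  `--supports stmt-QuantumFields-19200 --as helper`; count-neutral.

WHAT IS PROVED (by `exact` from `Prop7SectET3ObjectsPd` with `e := siteEquivTower F n K h`, `he := siteEquivTower_shiftEquiv h`; the background they produce IS
`bgOfCfgTower F n K h U₀` by `rfl`, `bgOfCfgTower_eq`): **`inU2cur_tower_of_regPr`** ([Balaban1985Variational] (2)/(14) current clause `InU2cur L η (lev ≡ K − n) a (bgOfCfgTower …)`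
from `RegPr F n K a U₀`, `η = L^{−(K−n)}`) and ★★ **`prop6_tower`** (Proposition 6 = `B11Prop6Concrete.exists_solution_concrete` at the tower objects: `hU`, `h14` DISCHARGED; letters
`𝒢 = 𝔊(U₀)` with ‖𝒢f‖ ≤ B₀‖f‖ = `SectEDatum.norm_G` ([Balaban1985BackgroundPropagators] Thm 3.13, N06(d = 3), DISPLAYED) and `W = (δ/δA′)V` quadratic-analytic (Prop. 4, DISPLAYED
— ★w4-20520 g2's `Prop7SectET3Prop4.exists_prop4Hyp_W80_latticeFree` ∕ `…Prop4Tower` conclusion `.quadAnalytic` binds HERE on the nose), `U₀ ∈ 𝔘_k(C₁B₃ε₁)` in full).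
v1.1 (append-only): §RowsAt — the same two rows with the height a FREE letter `k`, `n + k = K` (`inU2cur_towerAt_of_regPr`, ★★`prop6_towerAt` at
`siteEquivTowerAt F n K k hk` ∕ `bgOfCfgTowerAt`, OWNER 02:47:05Z amended lattice-of-record text; take `k := N + 1`).
C-min at the tower lattice is `Prop7CminOfP6T3Pd.Cmin_of_P6T3_chart_growth_pd hL hB₃ (fun i => towerP i.1.1.L (towerPeriodsT3 i.1.1 i.1.2.1) (i.1.2.2 − i.1.2.1))
(fun i => siteEquivTower i.1.1 i.1.2.1 i.1.2.2 i.2.2.le) (fun i => siteEquivTower_shiftEquiv i.2.2.le) …` (p597651; no restatement here).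

HONEST SCOPE.  Instantiation only; no estimate.  References: T. Bałaban, CMP 102 (1985) 277–309 [Balaban1985Variational] ((2) p.278, (14) p.280, (111) p.294, (117) p.295,
Prop. 6 p.295); CMP 99 (1985) 389–434 [Balaban1985BackgroundPropagators] (Thm 3.13 p.423).
-/

noncomputable section

open scoped Matrix.Norms.L2Operator

namespace Summit.QuantumFields.YangMills.Theorems.Prop7SectET3TowerRows

open Literature.MathematicalPhysics.QuantumFieldTheory.Balaban1983to89
open T3ContinuumYM3Torus T3PrintedRegularMinimiser
open B4Sect5Torus (TSite)
open B9SectCLatticeCarrier (Bond)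
open B9Eq315QTower (towerP)
open B10Eq27TorusAxialLog (unitsField toUField)
open B11Prop6Concrete (InU2cur)
open B11Eq115Space (NegSize Space115)
open B11Eq111FrakG (nabla115)
open B11Eq98CurrentSlot (Jcur)
open B13Contraction113 (QuadAnalytic)
open Summit.QuantumFields.YangMills.Theorems.Prop7SectET3TransportTower (towerPeriodsT3 siteEquivTower siteEquivTower_shiftEquiv bgOfCfgTower
  siteEquivTowerAt siteEquivTowerAt_shiftEquiv bgOfCfgTowerAt)
open Summit.QuantumFields.YangMills.Theorems.Prop7SectET3ObjectsPd (inU2cur_of_regPr prop6_T3)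

/-! ## The (α)-rows at the lattice of record -/

section Rows

variable (F : T3Family) (n K : ℕ) (h : n ≤ K)

/-- **(2)/(14)'s CURRENT CLAUSE ON THE TOWER LATTICE**: `RegPr F n K a U₀` puts the background read at `siteEquivTower` in lit-balaban's current class
`InU2cur L η (lev ≡ K − n) a`, `η = L^{−(K−n)}`. [cite: Balaban1985Variational, (2) p.278, (14) p.280] -/
theorem inU2cur_tower_of_regPr {a : ℝ} (U₀ : GaugeField (F.P K) 0 (Matrix.specialUnitaryGroup (Fin 2) ℂ)) (hreg : RegPr F n K a U₀) :
    InU2cur (F.L : ℝ) (((F.L : ℝ)⁻¹) ^ (K - n)) (fun _ : Bond 3 (towerP F.L (towerPeriodsT3 F n) (K - n)) => K - n) a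
      (bgOfCfgTower F n K h U₀) :=
  inU2cur_of_regPr (siteEquivTower F n K h) (fun x μ => siteEquivTower_shiftEquiv h x μ) U₀ hreg

/-- ★★ **PROPOSITION 6 (i)/(ii) AT THE LATTICE OF RECORD** (`Prop7SectET3ObjectsPd.prop6_T3` at `e := siteEquivTower F n K h`, background `bgOfCfgTower F n K h U₀` by `rfl`): background read on `Bond 3 (towerP F.L (towerPeriodsT3 F n) (K - n))`,
levels `≡ K − n`, `η = L^{−(K−n)}`; letters `𝒢 = 𝔊(U₀)` (‖𝒢f‖ ≤ B₀‖f‖ — `SectEDatum.norm_G`, N06(d = 3), DISPLAYED), `W = (δ/δA′)V` (Prop. 4, DISPLAYED — ★w4-20520 g2's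
`Prop4Hyp (W80 …)`.quadAnalytic binds here), `U₀ ∈ 𝔘_k(C₁B₃ε₁)` in full (`RegPr`): Eq. (111) with the concrete current has exactly one solution in the (115)-ball `ε₄`, of size
`< 3B₀C₁B₃ε₁`. [cite: Balaban1985Variational, Prop. 6 p.295, (111) p.294, (117) p.295] -/
theorem prop6_tower [Fact (0 < (F.L : ℝ))] [Fact (0 < ((F.L : ℝ)⁻¹) ^ (K - n))] {B₀ C₄ a₃ C₁ B₃ ε₁ ε₄ : ℝ}
    (U₀ : GaugeField (F.P K) 0 (Matrix.specialUnitaryGroup (Fin 2) ℂ))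
    {𝒢 : NegSize (F.L : ℝ) (((F.L : ℝ)⁻¹) ^ (K - n)) (fun _ : Bond 3 (towerP F.L (towerPeriodsT3 F n) (K - n)) => K - n) 3 (Matrix (Fin 2) (Fin 2) ℂ) →L[ℂ]
          Space115 (F.L : ℝ) (((F.L : ℝ)⁻¹) ^ (K - n)) (fun _ : Bond 3 (towerP F.L (towerPeriodsT3 F n) (K - n)) => K - n) (fun _ : Bond 3 (towerP F.L (towerPeriodsT3 F n) (K - n)) × Fin 3 => K - n)
            (nabla115 (((F.L : ℝ)⁻¹) ^ (K - n)) (bgOfCfgTower F n K h U₀))}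
    {W : Space115 (F.L : ℝ) (((F.L : ℝ)⁻¹) ^ (K - n)) (fun _ : Bond 3 (towerP F.L (towerPeriodsT3 F n) (K - n)) => K - n) (fun _ : Bond 3 (towerP F.L (towerPeriodsT3 F n) (K - n)) × Fin 3 => K - n)
            (nabla115 (((F.L : ℝ)⁻¹) ^ (K - n)) (bgOfCfgTower F n K h U₀)) →
          NegSize (F.L : ℝ) (((F.L : ℝ)⁻¹) ^ (K - n)) (fun _ : Bond 3 (towerP F.L (towerPeriodsT3 F n) (K - n)) => K - n) 3 (Matrix (Fin 2) (Fin 2) ℂ)}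
    (h𝒢 : ∀ f, ‖𝒢 f‖ ≤ B₀ * ‖f‖) (hW : QuadAnalytic W C₄ a₃) (hB₀ : 0 < B₀) (hC₄ : 0 < C₄) (hC₁ : 0 < C₁) (hB₃ : 0 < B₃) (hε₁ : 0 < ε₁)
    (hdLB₃ : (3 : ℝ) * F.L ≤ B₃) (h1 : 2 * B₀ * C₁ * B₃ * ε₁ ≤ ε₄) (h2 : 4 * ε₄ ≤ a₃) (h3 : 16 * B₀ * C₄ * ε₄ ≤ 1)
    (hreg : RegPr F n K (C₁ * B₃ * ε₁) U₀)
    {𝔄 : Space115 (F.L : ℝ) (((F.L : ℝ)⁻¹) ^ (K - n)) (fun _ : Bond 3 (towerP F.L (towerPeriodsT3 F n) (K - n)) => K - n) (fun _ : Bond 3 (towerP F.L (towerPeriodsT3 F n) (K - n)) × Fin 3 => K - n)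
            (nabla115 (((F.L : ℝ)⁻¹) ^ (K - n)) (bgOfCfgTower F n K h U₀))}
    (h𝔄 : ‖𝔄‖ < 2 * ((3 : ℝ) * F.L) * B₀ * C₁ * ε₁) :
    ∃ A₁ : Space115 (F.L : ℝ) (((F.L : ℝ)⁻¹) ^ (K - n)) (fun _ : Bond 3 (towerP F.L (towerPeriodsT3 F n) (K - n)) => K - n) (fun _ : Bond 3 (towerP F.L (towerPeriodsT3 F n) (K - n)) × Fin 3 => K - n)
            (nabla115 (((F.L : ℝ)⁻¹) ^ (K - n)) (bgOfCfgTower F n K h U₀)),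
      ‖A₁‖ < ε₄ ∧
      A₁ + 𝒢 (Jcur (bgOfCfgTower F n K h U₀)) + 𝒢 (W (A₁ + 𝔄)) = 0 ∧
      ‖A₁‖ < 3 * B₀ * C₁ * B₃ * ε₁ ∧
      ∀ A₁' : Space115 (F.L : ℝ) (((F.L : ℝ)⁻¹) ^ (K - n)) (fun _ : Bond 3 (towerP F.L (towerPeriodsT3 F n) (K - n)) => K - n) (fun _ : Bond 3 (towerP F.L (towerPeriodsT3 F n) (K - n)) × Fin 3 => K - n)
            (nabla115 (((F.L : ℝ)⁻¹) ^ (K - n)) (bgOfCfgTower F n K h U₀)),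
        ‖A₁'‖ < ε₄ →
        A₁' + 𝒢 (Jcur (bgOfCfgTower F n K h U₀)) + 𝒢 (W (A₁' + 𝔄)) = 0 →
        A₁' = A₁ :=
  prop6_T3 (siteEquivTower F n K h) (fun x μ => siteEquivTower_shiftEquiv h x μ) U₀ h𝒢 hW hB₀ hC₄ hC₁ hB₃ hε₁ hdLB₃ h1 h2 h3 hreg h𝔄

end Rows

/-! ## The (α)-rows at the lattice of record with the height a FREE letter `k`, `n + k = K` (OWNER 02:47:05Z amended text: chart `siteEquivTowerAt`) -/

section RowsAt

variable (F : T3Family) (n K k : ℕ) (hk : n + k = K)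

/-- **(2)/(14)'s CURRENT CLAUSE ON THE TOWER LATTICE OF HEIGHT `k`, `n + k = K`**: `RegPr F n K a U₀` puts the background read at `siteEquivTower` in lit-balaban's current class
`InU2cur L η (lev ≡ K − n) a`, `η = L^{−(K−n)}`. [cite: Balaban1985Variational, (2) p.278, (14) p.280] -/
theorem inU2cur_towerAt_of_regPr {a : ℝ} (U₀ : GaugeField (F.P K) 0 (Matrix.specialUnitaryGroup (Fin 2) ℂ)) (hreg : RegPr F n K a U₀) :
    InU2cur (F.L : ℝ) (((F.L : ℝ)⁻¹) ^ (K - n)) (fun _ : Bond 3 (towerP F.L (towerPeriodsT3 F n) k) => K - n) a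
      (bgOfCfgTowerAt F n K k hk U₀) :=
  inU2cur_of_regPr (siteEquivTowerAt F n K k hk) (fun x μ => siteEquivTowerAt_shiftEquiv hk x μ) U₀ hreg

/-- ★★ **PROPOSITION 6 (i)/(ii) AT THE LATTICE OF RECORD, HEIGHT A FREE LETTER `k` (take `k := N + 1` to meet the successor-indexed tower letters)** (`Prop7SectET3ObjectsPd.prop6_T3` at `e := siteEquivTowerAt F n K k hk`, background `bgOfCfgTowerAt F n K k hk U₀` by `rfl`): background read on `Bond 3 (towerP F.L (towerPeriodsT3 F n) k)`,
levels `≡ K − n`, `η = L^{−(K−n)}`; letters `𝒢 = 𝔊(U₀)` (‖𝒢f‖ ≤ B₀‖f‖ — `SectEDatum.norm_G`, N06(d = 3), DISPLAYED), `W = (δ/δA′)V` (Prop. 4, DISPLAYED — ★w4-20520 g2's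
`Prop4Hyp (W80 …)`.quadAnalytic binds here), `U₀ ∈ 𝔘_k(C₁B₃ε₁)` in full (`RegPr`): Eq. (111) with the concrete current has exactly one solution in the (115)-ball `ε₄`, of size
`< 3B₀C₁B₃ε₁`. [cite: Balaban1985Variational, Prop. 6 p.295, (111) p.294, (117) p.295] -/
theorem prop6_towerAt [Fact (0 < (F.L : ℝ))] [Fact (0 < ((F.L : ℝ)⁻¹) ^ (K - n))] {B₀ C₄ a₃ C₁ B₃ ε₁ ε₄ : ℝ}
    (U₀ : GaugeField (F.P K) 0 (Matrix.specialUnitaryGroup (Fin 2) ℂ))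
    {𝒢 : NegSize (F.L : ℝ) (((F.L : ℝ)⁻¹) ^ (K - n)) (fun _ : Bond 3 (towerP F.L (towerPeriodsT3 F n) k) => K - n) 3 (Matrix (Fin 2) (Fin 2) ℂ) →L[ℂ]
          Space115 (F.L : ℝ) (((F.L : ℝ)⁻¹) ^ (K - n)) (fun _ : Bond 3 (towerP F.L (towerPeriodsT3 F n) k) => K - n) (fun _ : Bond 3 (towerP F.L (towerPeriodsT3 F n) k) × Fin 3 => K - n)
            (nabla115 (((F.L : ℝ)⁻¹) ^ (K - n)) (bgOfCfgTowerAt F n K k hk U₀))}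
    {W : Space115 (F.L : ℝ) (((F.L : ℝ)⁻¹) ^ (K - n)) (fun _ : Bond 3 (towerP F.L (towerPeriodsT3 F n) k) => K - n) (fun _ : Bond 3 (towerP F.L (towerPeriodsT3 F n) k) × Fin 3 => K - n)
            (nabla115 (((F.L : ℝ)⁻¹) ^ (K - n)) (bgOfCfgTowerAt F n K k hk U₀)) →
          NegSize (F.L : ℝ) (((F.L : ℝ)⁻¹) ^ (K - n)) (fun _ : Bond 3 (towerP F.L (towerPeriodsT3 F n) k) => K - n) 3 (Matrix (Fin 2) (Fin 2) ℂ)}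
    (h𝒢 : ∀ f, ‖𝒢 f‖ ≤ B₀ * ‖f‖) (hW : QuadAnalytic W C₄ a₃) (hB₀ : 0 < B₀) (hC₄ : 0 < C₄) (hC₁ : 0 < C₁) (hB₃ : 0 < B₃) (hε₁ : 0 < ε₁)
    (hdLB₃ : (3 : ℝ) * F.L ≤ B₃) (h1 : 2 * B₀ * C₁ * B₃ * ε₁ ≤ ε₄) (h2 : 4 * ε₄ ≤ a₃) (h3 : 16 * B₀ * C₄ * ε₄ ≤ 1)
    (hreg : RegPr F n K (C₁ * B₃ * ε₁) U₀)
    {𝔄 : Space115 (F.L : ℝ) (((F.L : ℝ)⁻¹) ^ (K - n)) (fun _ : Bond 3 (towerP F.L (towerPeriodsT3 F n) k) => K - n) (fun _ : Bond 3 (towerP F.L (towerPeriodsT3 F n) k) × Fin 3 => K - n)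
            (nabla115 (((F.L : ℝ)⁻¹) ^ (K - n)) (bgOfCfgTowerAt F n K k hk U₀))}
    (h𝔄 : ‖𝔄‖ < 2 * ((3 : ℝ) * F.L) * B₀ * C₁ * ε₁) :
    ∃ A₁ : Space115 (F.L : ℝ) (((F.L : ℝ)⁻¹) ^ (K - n)) (fun _ : Bond 3 (towerP F.L (towerPeriodsT3 F n) k) => K - n) (fun _ : Bond 3 (towerP F.L (towerPeriodsT3 F n) k) × Fin 3 => K - n)
            (nabla115 (((F.L : ℝ)⁻¹) ^ (K - n)) (bgOfCfgTowerAt F n K k hk U₀)),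
      ‖A₁‖ < ε₄ ∧
      A₁ + 𝒢 (Jcur (bgOfCfgTowerAt F n K k hk U₀)) + 𝒢 (W (A₁ + 𝔄)) = 0 ∧
      ‖A₁‖ < 3 * B₀ * C₁ * B₃ * ε₁ ∧
      ∀ A₁' : Space115 (F.L : ℝ) (((F.L : ℝ)⁻¹) ^ (K - n)) (fun _ : Bond 3 (towerP F.L (towerPeriodsT3 F n) k) => K - n) (fun _ : Bond 3 (towerP F.L (towerPeriodsT3 F n) k) × Fin 3 => K - n)
            (nabla115 (((F.L : ℝ)⁻¹) ^ (K - n)) (bgOfCfgTowerAt F n K k hk U₀)),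
        ‖A₁'‖ < ε₄ →
        A₁' + 𝒢 (Jcur (bgOfCfgTowerAt F n K k hk U₀)) + 𝒢 (W (A₁' + 𝔄)) = 0 →
        A₁' = A₁ :=
  prop6_T3 (siteEquivTowerAt F n K k hk) (fun x μ => siteEquivTowerAt_shiftEquiv hk x μ) U₀ h𝒢 hW hB₀ hC₄ hC₁ hB₃ hε₁ hdLB₃ h1 h2 h3 hreg h𝔄

end RowsAt

end Summit.QuantumFields.YangMills.Theorems.Prop7SectET3TowerRows

end
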